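import Mathlib

/-!
# `MatrixDescartes` census — the GÅRDING DICTIONARY at `(3,4)`, rows N1/N2: real-rootedness of `det (t P + X)` for `P ≻ 0` and Newton's inequalities

HONEST FRAMING.  Object-search cell `pub-symmetroid`, beside ONE typed statement `DoorA34 = PosRootLawAt 3 4 18` (route item
`Theses.LacunarySymmetroid.DoorA34`, stmt-ValiantsHypothesis-19980; OPEN, asserted nowhere).  The cell's only support-level certificate
instrument at `(3,4)` (engine-2 `LP34-CERT.md`) uses, besides the Newton cone C25 (`Census.newton_cone_det_pencil`), «Gårding rows» valid
when a letter `P = S_l` is DEFINITE: the cubic `t ↦ det (t P + X)` is real-rooted (generalised symmetric-definite eigenproblem), so its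
coefficients satisfy Newton's inequalities — row N1 `c₂² ≥ 3 c₃ c₁` and row N2 `c₁² ≥ 3 c₂ c₀` (`c₃ = det P`, `c₀ = det X`).  This file
puts that dictionary in the kernel, for general size where the proof is uniform:

* `det_X_smul_congr_eq` — congruence pulls out: `det (X • (M Mᵀ) + M Y Mᵀ) = C (det M)² · det (X • 1 + Y)` (polynomial matrices);
* `det_X_smul_one_add_eq_charpoly_neg` — `det (X • 1 + Y) = charpoly (−Y)`;
* `exists_mul_transpose_of_posDef` — a real positive definite matrix is `M Mᵀ` with `det M ≠ 0` (spectral theorem);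
* `splits_det_pencil_of_posDef` — **for `P ≻ 0` and `Y` symmetric (any size), the polynomial `det (X • P + Y)` SPLITS over `ℝ`**
  (all roots real: they are minus the eigenvalues of `M⁻¹ Y M⁻ᵀ`, Mathlib's `Matrix.IsHermitian.splits_charpoly`);
* `newton_cubic_of_splits` — Newton's inequalities for a split real cubic; and the `(3,4)` instances the LP uses:
  `garding_rows_three` (N1 and N2 for `det (X • P + Y)`, `P ≻ 0`, `Y` symmetric `3 × 3`), with the end coefficients identified
  (`coeff 3 = det P`, `coeff 0 = det Y`: Mathlib `coeff_det_X_add_C_card/zero`); the middle coefficients are the mixed terms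
  `tr(adj P · Y)`, `tr(adj Y · P)` of the census dictionary (identification left to the certificate generator, `det_fin_three`).

These rows only fire on a DEFINITE letter; the all-indefinite word of `DoorA34`'s residue is untouched (LP34-CERT §4).  Nothing here is a
bound on `ζ_sym(3,4)`; nothing bears on `MatrixDescartes` (stmt-ValiantsHypothesis-18050) or `VP ≠ VNP`.

[folklore] Gårding hyperbolicity of `det` on symmetric matrices / Newton's inequalities; textbook linear algebra, no single source.
-/

-- `Summit.ValiantsHypothesis.ValiantsHypothesis.…` repeats a component by the D-0017 layout
-- (single-conjunct summit), which the `dupNamespace` linter flags; the name is mandated.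
set_option linter.dupNamespace false

namespace Summit.ValiantsHypothesis.ValiantsHypothesis.Theorems.LacunarySymmetroidMatrixDescartes.Census

open Polynomial Matrix Finset
open scoped BigOperators Polynomial Matrix

section general

variable {n : Type*} [Fintype n] [DecidableEq n]

/-- The image of a real matrix under `C` has determinant `C (det M)`. [folklore] -/
theorem det_map_C_eq (M : Matrix n n ℝ) : (M.map (C : ℝ → ℝ[X])).det = C M.det := by
  rw [show M.map (C : ℝ → ℝ[X]) = (C : ℝ →+* ℝ[X]).mapMatrix M from rfl, ← RingHom.map_det]

/-- **Congruence pulls out of the pencil polynomial**: `det (X • (M Mᵀ) + M Y Mᵀ) = C (det M)² · det (X • 1 + Y)` as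
polynomials (all matrices mapped into `ℝ[X]` by `C`). [folklore] -/
theorem det_X_smul_congr_eq (M Y : Matrix n n ℝ) :
    ((X : ℝ[X]) • (M * Mᵀ).map C + (M * Y * Mᵀ).map C).det
      = C (M.det ^ 2) * ((X : ℝ[X]) • (1 : Matrix n n ℝ[X]) + Y.map C).det := by
  have h : M.map C * ((X : ℝ[X]) • (1 : Matrix n n ℝ[X]) + Y.map C) * Mᵀ.map C
      = (X : ℝ[X]) • (M * Mᵀ).map C + (M * Y * Mᵀ).map C := by
    rw [Matrix.map_mul, Matrix.map_mul, Matrix.map_mul, Matrix.mul_add, Matrix.add_mul, Matrix.mul_smul,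
      Matrix.mul_one, Matrix.smul_mul]
  rw [← h, det_mul, det_mul, Matrix.transpose_map, det_transpose, det_map_C_eq, map_pow]
  ring

/-- `det (X • 1 + Y) = charpoly (−Y)`. [folklore] -/
theorem det_X_smul_one_add_eq_charpoly_neg (Y : Matrix n n ℝ) :
    ((X : ℝ[X]) • (1 : Matrix n n ℝ[X]) + Y.map C).det = (-Y).charpoly := by
  unfold Matrix.charpoly
  congr 1
  ext i j
  by_cases hij : i = j
  · subst hij
    simp [Matrix.charmatrix_apply_eq]
  · simp [hij]

omit [Fintype n] [DecidableEq n] in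
/-- Over `ℝ`, a symmetric matrix is Hermitian (and so is its negative). [folklore] -/
theorem isHermitian_neg_of_isSymm {Y : Matrix n n ℝ} (hY : Y.IsSymm) : (-Y).IsHermitian := by
  have h : Y.IsHermitian := by
    unfold Matrix.IsHermitian
    rw [conjTranspose_eq_transpose_of_trivial]
    exact hY
  exact h.neg

/-- **Real-rootedness in congruence form**: for ANY real `M` and symmetric `Y`, the polynomial
`det (X • (M Mᵀ) + M Y Mᵀ)` splits over `ℝ`. [folklore] -/
theorem splits_det_pencil_congr (M : Matrix n n ℝ) {Y : Matrix n n ℝ} (hY : Y.IsSymm) :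
    (((X : ℝ[X]) • (M * Mᵀ).map C + (M * Y * Mᵀ).map C).det).Splits := by
  rw [det_X_smul_congr_eq, det_X_smul_one_add_eq_charpoly_neg]
  exact (isHermitian_neg_of_isSymm hY).splits_charpoly.C_mul _

/-- **A real positive definite matrix is a Gram matrix of an invertible one**: `P = M Mᵀ`, `det M ≠ 0`
(`M = U · diag(√λ)` from the spectral theorem). [folklore] -/
theorem exists_mul_transpose_of_posDef {P : Matrix n n ℝ} (hP : P.PosDef) :
    ∃ M : Matrix n n ℝ, M.det ≠ 0 ∧ P = M * Mᵀ := by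
  have hA : P.IsHermitian := hP.1
  set U : Matrix n n ℝ := (hA.eigenvectorUnitary : Matrix n n ℝ) with hU
  set D : Matrix n n ℝ := diagonal (fun i => Real.sqrt (hA.eigenvalues i)) with hD
  have hUU : U * Uᵀ = 1 := by
    have h := Unitary.coe_mul_star_self hA.eigenvectorUnitary
    rw [Unitary.coe_star, Matrix.star_eq_conjTranspose, conjTranspose_eq_transpose_of_trivial] at h
    exact h
  refine ⟨U * D, ?_, ?_⟩
  · have hUdet : U.det ≠ 0 := by
      have h := congrArg Matrix.det hUU
      rw [det_mul, det_one] at h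
      exact left_ne_zero_of_mul_eq_one h
    rw [det_mul, hD, det_diagonal]
    exact mul_ne_zero hUdet (Finset.prod_ne_zero_iff.2 fun i _ => (Real.sqrt_pos.2 (hP.eigenvalues_pos i)).ne')
  · have hDD : D * Dᵀ = diagonal hA.eigenvalues := by
      rw [hD, diagonal_transpose, diagonal_mul_diagonal]
      congr 1
      funext i
      exact Real.mul_self_sqrt (hP.eigenvalues_pos i).le
    have hspec := hA.spectral_theorem
    rw [Unitary.conjStarAlgAut_apply, Matrix.star_eq_conjTranspose,
      conjTranspose_eq_transpose_of_trivial] at hspec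
    have hdiag : diagonal (RCLike.ofReal ∘ hA.eigenvalues : n → ℝ) = diagonal hA.eigenvalues := by
      congr 1
    rw [hdiag] at hspec
    calc P = U * diagonal hA.eigenvalues * Uᵀ := hspec
      _ = U * (D * Dᵀ) * Uᵀ := by rw [hDD]
      _ = U * D * (U * D)ᵀ := by rw [transpose_mul, Matrix.mul_assoc, Matrix.mul_assoc, Matrix.mul_assoc]

/-- **GÅRDING / real-rootedness (any size)**: for a real POSITIVE DEFINITE `P` and a real SYMMETRIC `Y`, the pencil polynomial
`det (X • P + Y) ∈ ℝ[X]` splits over `ℝ` — all its roots are real (they are `−λᵢ(M⁻¹ Y M⁻ᵀ)` for `P = M Mᵀ`).  This is the source of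
every magnitude row the cell has for symmetric pencils with a definite letter. [folklore] -/
theorem splits_det_pencil_of_posDef {P Y : Matrix n n ℝ} (hP : P.PosDef) (hY : Y.IsSymm) :
    (((X : ℝ[X]) • P.map C + Y.map C).det).Splits := by
  obtain ⟨M, hM, rfl⟩ := exists_mul_transpose_of_posDef hP
  have hMu : IsUnit M.det := isUnit_iff_ne_zero.2 hM
  have hMT : IsUnit Mᵀ.det := by rw [det_transpose]; exact hMu
  -- `Y = M Y' Mᵀ` with `Y' = M⁻¹ Y M⁻ᵀ` symmetric
  set Y' : Matrix n n ℝ := M⁻¹ * Y * Mᵀ⁻¹ with hY'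
  have hYY : Y = M * Y' * Mᵀ := by
    rw [hY']
    calc Y = (M * M⁻¹) * Y * (Mᵀ⁻¹ * Mᵀ) := by
          rw [Matrix.mul_nonsing_inv M hMu, Matrix.nonsing_inv_mul Mᵀ hMT, Matrix.one_mul, Matrix.mul_one]
      _ = M * (M⁻¹ * Y * Mᵀ⁻¹) * Mᵀ := by simp only [Matrix.mul_assoc]
  have hY's : Y'.IsSymm := by
    rw [hY']
    unfold Matrix.IsSymm
    rw [transpose_mul, transpose_mul, ← transpose_nonsing_inv, transpose_transpose, hY.eq, transpose_nonsing_inv,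
      Matrix.mul_assoc]
  rw [hYY]
  exact splits_det_pencil_congr M hY's

/-- **Newton's inequalities for a split real cubic**: if `p ∈ ℝ[X]` has degree `3` and splits over `ℝ`, then
`3 c₃ c₁ ≤ c₂²` and `3 c₂ c₀ ≤ c₁²` (with roots `r, s, u`: the two differences are `c₃² · ½ Σ (r − s)²` and
`c₃² · ½ Σ (rs − ru)²`). [folklore] -/
theorem newton_cubic_of_splits {p : ℝ[X]} (hp : p.Splits) (h3 : p.natDegree = 3) :
    3 * (p.coeff 3 * p.coeff 1) ≤ p.coeff 2 ^ 2 ∧ 3 * (p.coeff 2 * p.coeff 0) ≤ p.coeff 1 ^ 2 := by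
  have hcard : Multiset.card p.roots = 3 := by rw [splits_iff_card_roots.1 hp, h3]
  obtain ⟨r, s, u, hrs⟩ := Multiset.card_eq_three.1 hcard
  set a := p.leadingCoeff with ha
  have hp' : p = C a * X ^ 3 + C (-(a * (r + s + u))) * X ^ 2 + C (a * (r * s + r * u + s * u)) * X ^ 1
      + C (-(a * (r * s * u))) * X ^ 0 := by
    have h := hp.eq_prod_roots
    rw [hrs] at h
    rw [h, ← ha]
    simp only [Multiset.insert_eq_cons, Multiset.map_cons, Multiset.map_singleton, Multiset.prod_cons,
      Multiset.prod_singleton, map_neg, map_mul, map_add]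
    ring
  have hc : ∀ k : ℕ, p.coeff k = (if k = 3 then a else 0) + (if k = 2 then -(a * (r + s + u)) else 0)
      + (if k = 1 then a * (r * s + r * u + s * u) else 0) + (if k = 0 then -(a * (r * s * u)) else 0) := by
    intro k
    rw [hp']
    simp only [coeff_add, coeff_C_mul_X_pow]
  have c3 : p.coeff 3 = a := by rw [hc]; norm_num
  have c2 : p.coeff 2 = -(a * (r + s + u)) := by rw [hc]; norm_num
  have c1 : p.coeff 1 = a * (r * s + r * u + s * u) := by rw [hc]; norm_num
  have c0 : p.coeff 0 = -(a * (r * s * u)) := by rw [hc]; norm_num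
  rw [c3, c2, c1, c0]
  constructor
  · nlinarith [mul_nonneg (sq_nonneg a) (sq_nonneg (r - s)), mul_nonneg (sq_nonneg a) (sq_nonneg (r - u)),
      mul_nonneg (sq_nonneg a) (sq_nonneg (s - u))]
  · nlinarith [mul_nonneg (sq_nonneg a) (sq_nonneg (r * s - r * u)), mul_nonneg (sq_nonneg a) (sq_nonneg (r * s - s * u)),
      mul_nonneg (sq_nonneg a) (sq_nonneg (r * u - s * u))]

end general

/-! ## The `(3,4)` instances: rows N1 / N2 of the census dictionary -/

/-- End coefficients of the `3 × 3` pencil polynomial: `coeff 3 = det P`, `coeff 0 = det Y` (Mathlib). [folklore] -/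
theorem coeff_det_pencil_three_ends (P Y : Matrix (Fin 3) (Fin 3) ℝ) :
    (((X : ℝ[X]) • P.map C + Y.map C).det).coeff 3 = P.det ∧ (((X : ℝ[X]) • P.map C + Y.map C).det).coeff 0 = Y.det := by
  refine ⟨?_, coeff_det_X_add_C_zero P Y⟩
  have h := coeff_det_X_add_C_card P Y
  rw [Fintype.card_fin] at h
  exact h

/-- For `P ≻ 0` the `3 × 3` pencil polynomial has degree exactly `3`. [folklore] -/
theorem natDegree_det_pencil_three {P : Matrix (Fin 3) (Fin 3) ℝ} (hP : P.PosDef) (Y : Matrix (Fin 3) (Fin 3) ℝ) :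
    (((X : ℝ[X]) • P.map C + Y.map C).det).natDegree = 3 := by
  have hle : (((X : ℝ[X]) • P.map C + Y.map C).det).natDegree ≤ 3 := by
    have h := natDegree_det_X_add_C_le P Y
    rw [Fintype.card_fin] at h
    exact h
  refine le_antisymm hle ?_
  refine le_natDegree_of_ne_zero ?_
  rw [(coeff_det_pencil_three_ends P Y).1]
  exact hP.det_pos.ne'

/-- **GÅRDING ROWS N1 and N2 at `(3,4)`** (engine-2 `LP34-CERT.md` §2, for a positive definite letter): for `P ≻ 0` and `Y`
symmetric `3 × 3`, the coefficients `c₀, …, c₃` of `det (X • P + Y)` satisfy `3 c₃ c₁ ≤ c₂²` and `3 c₂ c₀ ≤ c₁²`, where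
`c₃ = det P` and `c₀ = det Y` (`coeff_det_pencil_three_ends`).  For a NEGATIVE definite letter apply the theorem to `−P`
(`det (X • (−P) + Y)`).  In the census dictionary `c₂ = tr(adj P · Y) = 3 D(P,P,Y)` and `c₁ = tr(adj Y · P) = 3 D(P,Y,Y)`, so these
are the rows `D(PPY)² ≥ D(PPP) D(PYY)` and `D(PYY)² ≥ D(PPY) D(YYY)`. [folklore] -/
theorem garding_rows_three {P Y : Matrix (Fin 3) (Fin 3) ℝ} (hP : P.PosDef) (hY : Y.IsSymm) :
    3 * ((((X : ℝ[X]) • P.map C + Y.map C).det).coeff 3 * (((X : ℝ[X]) • P.map C + Y.map C).det).coeff 1)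
        ≤ (((X : ℝ[X]) • P.map C + Y.map C).det).coeff 2 ^ 2 ∧
      3 * ((((X : ℝ[X]) • P.map C + Y.map C).det).coeff 2 * (((X : ℝ[X]) • P.map C + Y.map C).det).coeff 0)
        ≤ (((X : ℝ[X]) • P.map C + Y.map C).det).coeff 1 ^ 2 :=
  newton_cubic_of_splits (splits_det_pencil_of_posDef hP hY) (natDegree_det_pencil_three hP Y)

/-- Row N1 with the end coefficient named: `3 · det P · c₁ ≤ c₂²`. [folklore] -/
theorem garding_row_N1 {P Y : Matrix (Fin 3) (Fin 3) ℝ} (hP : P.PosDef) (hY : Y.IsSymm) :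
    3 * (P.det * (((X : ℝ[X]) • P.map C + Y.map C).det).coeff 1)
      ≤ (((X : ℝ[X]) • P.map C + Y.map C).det).coeff 2 ^ 2 := by
  have h := (garding_rows_three hP hY).1
  rwa [(coeff_det_pencil_three_ends P Y).1] at h

/-- Row N2 with the end coefficient named: `3 · c₂ · det Y ≤ c₁²`. [folklore] -/
theorem garding_row_N2 {P Y : Matrix (Fin 3) (Fin 3) ℝ} (hP : P.PosDef) (hY : Y.IsSymm) :
    3 * ((((X : ℝ[X]) • P.map C + Y.map C).det).coeff 2 * Y.det)
      ≤ (((X : ℝ[X]) • P.map C + Y.map C).det).coeff 1 ^ 2 := by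
  have h := (garding_rows_three hP hY).2
  rwa [(coeff_det_pencil_three_ends P Y).2] at h

end Summit.ValiantsHypothesis.ValiantsHypothesis.Theorems.LacunarySymmetroidMatrixDescartes.Census
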